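/-
Origin: expansion seat `prover-pub-hodgecm-mc-binder-1-g17-0`, handover #1243r2 2026-08-20T22:31:33Z md5 d790489a6a48 (223 l.; REPLACE of HodgeCM/Model/AdelicThetaTowerLift.lean — PKG file now 20b0d00d2853 (227 l., incl. packager Origin header); body of record eef0a2efd711 (223 l.) → d790489a6a48; owner sinst-1 #1243 (RUN 64) — CONSENT: sinst-1-g10 STATUS l.14541; token strike only: res_clsU minus the binder; NAMES for audit: HodgeCM.Model.ThetaAdelicSide.res_clsU) (`HOME/mc/pub-hodgecm-mc-binder-1-g17/campaign/new/AdelicThetaTowerLift.lean`, md5 d790489a6a48, 223 lines);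
landed by the gen-27 packager (p-g27) in gate run 65 REPLACES the earlier landed copy of `HodgeCM/Model/AdelicThetaTowerLift.lean` (verbatim).
-/
/-
Copyright (c) 2026 the pub-hodgecm formalisation cell (harness21).  New file, not vendored.
Origin: session prover-pub-hodgecm-mc-sinst-1-g9-0 (unit pub-hodgecm-mc-sinst-1-g9, S-INSTANCE CONSTRUCTOR gen 9; the (J2)↔(J4) seam of the
(J-Liu-Θ) junction behind E's row 9 `hΘ`, final packaging: the class map on the union over levels as an intertwiner, and its
`ℂ[U(V)(𝔸_f)]`-linear lift), 2026-08-20.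
Intended final place: `HodgeCM/Model/AdelicThetaTowerLift.lean` (NEW additive model-layer leaf; imports sinst-1's
`HodgeCM.Model.AdelicThetaTowerMap` (#1242) and `HodgeCM.Model.Binders.EquivariantLift` (#1237); nothing imports it; drop alone).
-/
import Summits.HodgeConjecture.HodgeCM.Model.AdelicThetaTowerMap
import Summits.HodgeConjecture.HodgeCM.Model.Binders.EquivariantLift

set_option autoImplicit false

/-!
# The class map on the saturated hol-germ theta module (all levels) is an intertwiner into the tower; its `ℂ[G]`-linear lift

For an adelic side `S` with the honest archimedean component, regime `hV`, slot `k`, weight functions `𝓕`: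
* `S.holSatU hV k 𝓕 := ⨆ (i : TLvl V), S.holSat hV k i.1 𝓕` — the saturated hol-germ part of the slot's adèlic theta module, ALL levels
  (a DIRECTED union: `mem_holSatU_iff`); stable under the `U(V)(𝔸_f)`-action (`rightShift_mem_holSatU`), whence the representation
  **`S.holSatRep hV k 𝓕 : Representation ℂ ↥V.adelicFin (S.holSatU hV k 𝓕)`** (right translation through `finToG`);
* **`S.clsU … : S.holSatU hV k 𝓕 →ₗ[ℂ] Tower … V`** — `clsAt` at any level carrying the form (`clsU_eq_clsAt`: independent of the choice,
  #1242 `clsAt_of_le`); **`clsU_holSatRep`**: `clsU (g • F) = act g (clsU F)`, i.e. `of g • clsU F = clsU (g • F)` (`of_smul_clsU`) —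
  `clsU` is an INTERTWINER from `holSatRep` to binder-1's `towerRep`;
* **`S.clsLift … : (S.holSatRep hV k 𝓕).asModule →ₗ[MonoidAlgebra ℂ ↥V.adelicFin] Tower … V`** := #1237 `EquivariantLift.lift`, with
  `clsU_mem_range_clsLift` and **`clsU_mem_iSup_range`**: every class `clsU F` lies in `⨆ ψ : (holSatRep).asModule →ₗ[A] Tower, range ψ` —
  the `oscImage`-shape of the (J3) dictionary for the module `Ω := (holSatRep).asModule`; for the dictionary's own `Ω t` (theta-3 O5
  coinvariants, axioms-1 (T1′)) compose `clsLift` with the `A`-linear theta distribution `θ̄ : Ω t → (holSatRep).asModule`.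
KERNEL only: 0 records, 0 `def … : Prop`, nothing cited; `#print axioms` ⊆ {propext, Classical.choice, Quot.sound}.
-/

noncomputable section

open MulAction NumberField
open Literature.NumberTheory.Automorphic Literature.NumberTheory.Weil1964
open Literature.Geometry.ComplexHyperbolic.BallModel (U21 x₀)
open Literature.AlgebraicGeometry.HodgeTheory Literature.AlgebraicGeometry.ShimuraVarieties
open Literature.NumberTheory.Automorphic.PicardCM
open Literature.NumberTheory.Transcendental (Arapura2012_Cor_15_4_6)
open HodgeCM.Model.SupplyResidual HodgeCM.Model.ThetaSpace HodgeCM.Model.LevelTranslate HodgeCM.Model.TowerLevel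
open HodgeCM.Model.TowerCarrier

namespace HodgeCM
namespace Model
namespace ThetaAdelicSide

section Union

variable {L : CMField} {ι₁ : L →+* ℂ} {V : HermSpace3 L ι₁} {c : SeesawCtx L} (S : ThetaAdelicSide V c)

/-- **The saturated hol-germ part of the slot's adèlic theta module, all levels** (directed union over the tower's index type). -/
def holSatU (hV : IsAnisotropic L V.Hm) (k : Fin 4)
    (𝓕 : Set C(NumberField.relNormOneIdeles (↥(maximalRealSubfield L)) L ⧸
      NumberField.relNormOneRat (↥(maximalRealSubfield L)) L, ℂ)) :
    Submodule ℂ ((V.latticeModel printFact_unitaryCompact_holds).G → (Fin 2 → ℂ)) :=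
  ⨆ i : TLvl V, S.holSat hV k i.1 𝓕

variable {𝓕 : Set C(NumberField.relNormOneIdeles (↥(maximalRealSubfield L)) L ⧸
    NumberField.relNormOneRat (↥(maximalRealSubfield L)) L, ℂ)}

/-- (Ported verbatim from the HodgeCMPerL package; no docstring in the source.) -/
theorem holSat_monotone (hV : IsAnisotropic L V.Hm) (k : Fin 4) :
    Monotone fun i : TLvl V => S.holSat hV k i.1 𝓕 := fun _ _ hij => S.holSat_mono hV k (TLvl.le_def.mp hij)

/-- (Ported verbatim from the HodgeCMPerL package; no docstring in the source.) -/
theorem holSat_le_holSatU (hV : IsAnisotropic L V.Hm) (k : Fin 4) (i : TLvl V) : S.holSat hV k i.1 𝓕 ≤ S.holSatU hV k 𝓕 :=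
  le_iSup (fun i : TLvl V => S.holSat hV k i.1 𝓕) i

/-- Membership in the union is membership at SOME level (the union is directed). -/
theorem mem_holSatU_iff (hV : IsAnisotropic L V.Hm) (k : Fin 4) {F : (V.latticeModel printFact_unitaryCompact_holds).G → (Fin 2 → ℂ)} :
    F ∈ S.holSatU hV k 𝓕 ↔ ∃ i : TLvl V, F ∈ S.holSat hV k i.1 𝓕 :=
  Submodule.mem_iSup_of_directed _ (S.holSat_monotone hV k).directed_le

/-- A chosen level carrying `F ∈ holSatU`. -/
def levelOf (hV : IsAnisotropic L V.Hm) (k : Fin 4) (F : S.holSatU hV k 𝓕) : TLvl V :=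
  ((S.mem_holSatU_iff hV k).mp F.2).choose

/-- (Ported verbatim from the HodgeCMPerL package; no docstring in the source.) -/
theorem mem_holSat_levelOf (hV : IsAnisotropic L V.Hm) (k : Fin 4) (F : S.holSatU hV k 𝓕) :
    F.1 ∈ S.holSat hV k (S.levelOf hV k F).1 𝓕 :=
  ((S.mem_holSatU_iff hV k).mp F.2).choose_spec

/-- (Ported verbatim from the HodgeCMPerL package; no docstring in the source.) -/
theorem holSatU_le_adelicThetaSpan (hV : IsAnisotropic L V.Hm) (k : Fin 4) :
    S.holSatU hV k 𝓕 ≤ adelicThetaSpan (S.P k) S.ιinf (stabilizer U21 x₀).subtype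
      (BallForms.isPullbackCocycle_cotangentCocycle.weightOf x₀) 𝓕 :=
  iSup_le fun i => S.holSat_le_adelicThetaSpan hV k i.1

/-- **`U(V)(𝔸_f)`-stability of the union.** -/
theorem rightShift_mem_holSatU (hV : IsAnisotropic L V.Hm) (k : Fin 4)
    {F : (V.latticeModel printFact_unitaryCompact_holds).G → (Fin 2 → ℂ)} (hF : F ∈ S.holSatU hV k 𝓕) (g : V.adelicFin) :
    rightShift (finToG V hV g) F ∈ S.holSatU hV k 𝓕 := by
  obtain ⟨i, hi⟩ := (S.mem_holSatU_iff hV k).mp hF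
  exact S.holSat_le_holSatU hV k (i.conj g) (S.rightShift_mem_holSat_conj hV k i.2 hi g)

/-- **The saturated hol-germ theta module as a representation of `U(V)(𝔸_f)`** (right translation through `finToG`). -/
def holSatRep (hV : IsAnisotropic L V.Hm) (k : Fin 4)
    (𝓕 : Set C(NumberField.relNormOneIdeles (↥(maximalRealSubfield L)) L ⧸
      NumberField.relNormOneRat (↥(maximalRealSubfield L)) L, ℂ)) :
    Representation ℂ V.adelicFin (S.holSatU hV k 𝓕) where
  toFun g := (rightShift (finToG V hV g)).restrict fun _ hF => S.rightShift_mem_holSatU hV k hF g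
  map_one' := by
    apply LinearMap.ext; intro F; apply Subtype.ext; funext x
    show F.1 (x * finToG V hV 1) = F.1 x
    rw [map_one, mul_one]
  map_mul' g g' := by
    apply LinearMap.ext; intro F; apply Subtype.ext; funext x
    show F.1 (x * finToG V hV (g * g')) = F.1 (x * finToG V hV g * finToG V hV g')
    rw [map_mul, mul_assoc]

/-- (Ported verbatim from the HodgeCMPerL package; no docstring in the source.) -/
@[simp] theorem coe_holSatRep_apply (hV : IsAnisotropic L V.Hm) (k : Fin 4) (g : V.adelicFin) (F : S.holSatU hV k 𝓕) :
    (S.holSatRep hV k 𝓕 g F).1 = rightShift (finToG V hV g) F.1 := rfl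

end Union

section Lift

variable (hHD : exists_isReal_hodgeModel) (hI : hodgePQ_independent_of_hodgeModel)
  (h₁ : BallQuotientUniformised) (h₃ : CMAbelianVarietyRealised) (hA : Arapura2012_Cor_15_4_6)
variable {L : CMField} {ι₁ : L →+* ℂ} {V : HermSpace3 L ι₁} {c : SeesawCtx L} (S : ThetaAdelicSide V c)
variable {𝓕 : Set C(NumberField.relNormOneIdeles (↥(maximalRealSubfield L)) L ⧸
    NumberField.relNormOneRat (↥(maximalRealSubfield L)) L, ℂ)}

/-- `clsAt` does not depend on the level carrying `F` (through a common refinement). -/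
theorem clsAt_eq_clsAt (hι : S.ιinf = archInfOf V) (hV : IsAnisotropic L V.Hm) (k : Fin 4) (i j : TLvl V)
    {F : (V.latticeModel printFact_unitaryCompact_holds).G → (Fin 2 → ℂ)}
    (hi : F ∈ S.holSat hV k i.1 𝓕) (hj : F ∈ S.holSat hV k j.1 𝓕) :
    S.clsAt hHD hI h₁ h₃ hA hι hV k i.1 i.2 𝓕 ⟨F, hi⟩ = S.clsAt hHD hI h₁ h₃ hA hι hV k j.1 j.2 𝓕 ⟨F, hj⟩ := by
  obtain ⟨m, him, hjm⟩ := exists_ge_ge i j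
  rw [← S.clsAt_of_le hHD hI h₁ h₃ hA hι hV k (TLvl.le_def.mp him) i.2 m.2 ⟨F, hi⟩,
    ← S.clsAt_of_le hHD hI h₁ h₃ hA hι hV k (TLvl.le_def.mp hjm) j.2 m.2 ⟨F, hj⟩]

variable (𝓕) in
/-- **The tower class map on all levels**: `clsAt` at a level carrying the form. -/
def clsU (hι : S.ιinf = archInfOf V) (hV : IsAnisotropic L V.Hm) (k : Fin 4) :
    S.holSatU hV k 𝓕 →ₗ[ℂ] Tower hHD hI (ballQuotientUniformisedDatum_of h₁) h₃ hA V where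
  toFun F := S.clsAt hHD hI h₁ h₃ hA hι hV k (S.levelOf hV k F).1 (S.levelOf hV k F).2 𝓕 ⟨F.1, S.mem_holSat_levelOf hV k F⟩
  map_add' F F' := by
    obtain ⟨m, h1, h2⟩ := exists_ge_ge (S.levelOf hV k F) (S.levelOf hV k F')
    obtain ⟨n, h3, h4⟩ := exists_ge_ge m (S.levelOf hV k (F + F'))
    have hF : F.1 ∈ S.holSat hV k n.1 𝓕 :=
      S.holSat_monotone hV k (h1.trans h3) (S.mem_holSat_levelOf hV k F)
    have hF' : F'.1 ∈ S.holSat hV k n.1 𝓕 :=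
      S.holSat_monotone hV k (h2.trans h3) (S.mem_holSat_levelOf hV k F')
    have hFF' : (F + F').1 ∈ S.holSat hV k n.1 𝓕 := Submodule.add_mem _ hF hF'
    rw [S.clsAt_eq_clsAt hHD hI h₁ h₃ hA hι hV k (S.levelOf hV k (F + F')) n (S.mem_holSat_levelOf hV k (F + F')) hFF',
      S.clsAt_eq_clsAt hHD hI h₁ h₃ hA hι hV k (S.levelOf hV k F) n (S.mem_holSat_levelOf hV k F) hF,
      S.clsAt_eq_clsAt hHD hI h₁ h₃ hA hι hV k (S.levelOf hV k F') n (S.mem_holSat_levelOf hV k F') hF', ← map_add]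
    rfl
  map_smul' r F := by
    have hF : (r • F).1 ∈ S.holSat hV k (S.levelOf hV k F).1 𝓕 :=
      Submodule.smul_mem _ r (S.mem_holSat_levelOf hV k F)
    rw [RingHom.id_apply,
      S.clsAt_eq_clsAt hHD hI h₁ h₃ hA hι hV k (S.levelOf hV k (r • F)) (S.levelOf hV k F) (S.mem_holSat_levelOf hV k (r • F)) hF,
      ← map_smul]
    rfl

/-- `clsU F = clsAt i F` for ANY level `i` carrying `F`. -/
theorem clsU_eq_clsAt (hι : S.ιinf = archInfOf V) (hV : IsAnisotropic L V.Hm) (k : Fin 4) (F : S.holSatU hV k 𝓕) (i : TLvl V)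
    (hi : F.1 ∈ S.holSat hV k i.1 𝓕) :
    S.clsU hHD hI h₁ h₃ hA 𝓕 hι hV k F = S.clsAt hHD hI h₁ h₃ hA hι hV k i.1 i.2 𝓕 ⟨F.1, hi⟩ :=
  S.clsAt_eq_clsAt hHD hI h₁ h₃ hA hι hV k _ i _ hi

/-- **`clsU` is an intertwiner**: `clsU (g • F) = act g (clsU F)`. -/
theorem clsU_holSatRep (hι : S.ιinf = archInfOf V) (hV : IsAnisotropic L V.Hm) (k : Fin 4) (g : V.adelicFin)
    (F : S.holSatU hV k 𝓕) :
    S.clsU hHD hI h₁ h₃ hA 𝓕 hι hV k (S.holSatRep hV k 𝓕 g F) =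
      act hHD hI (ballQuotientUniformisedDatum_of h₁) h₃ hA g (S.clsU hHD hI h₁ h₃ hA 𝓕 hι hV k F) := by
  set i := S.levelOf hV k F
  have hi : F.1 ∈ S.holSat hV k i.1 𝓕 := S.mem_holSat_levelOf hV k F
  rw [S.clsU_eq_clsAt hHD hI h₁ h₃ hA hι hV k F i hi,
    S.clsU_eq_clsAt hHD hI h₁ h₃ hA hι hV k _ (i.conj g) (S.rightShift_mem_holSat_conj hV k i.2 hi g)]
  exact S.clsAt_rightShift hHD hI h₁ h₃ hA hι hV k i.2 ⟨F.1, hi⟩ g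

/-- **`ℂ[U(V)(𝔸_f)]`-module form of the equivariance**: `of g • clsU F = clsU (g • F)`. -/
theorem of_smul_clsU (hι : S.ιinf = archInfOf V) (hV : IsAnisotropic L V.Hm) (k : Fin 4) (g : V.adelicFin)
    (F : S.holSatU hV k 𝓕) :
    S.clsU hHD hI h₁ h₃ hA 𝓕 hι hV k (S.holSatRep hV k 𝓕 g F) =
      MonoidAlgebra.of ℂ ↥V.adelicFin g • S.clsU hHD hI h₁ h₃ hA 𝓕 hι hV k F := by
  rw [of_smul_eq_act, clsU_holSatRep]

/-- **The `ℂ[U(V)(𝔸_f)]`-linear class map** on `(holSatRep).asModule` (#1237 `EquivariantLift.lift` against #R112's instances). -/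
def clsLift (hι : S.ιinf = archInfOf V) (hV : IsAnisotropic L V.Hm) (k : Fin 4)
    (𝓕 : Set C(NumberField.relNormOneIdeles (↥(maximalRealSubfield L)) L ⧸
      NumberField.relNormOneRat (↥(maximalRealSubfield L)) L, ℂ)) :
    (S.holSatRep hV k 𝓕).asModule →ₗ[MonoidAlgebra ℂ ↥V.adelicFin] Tower hHD hI (ballQuotientUniformisedDatum_of h₁) h₃ hA V :=
  EquivariantLift.lift (S.holSatRep hV k 𝓕) (S.clsU hHD hI h₁ h₃ hA 𝓕 hι hV k)
    (fun g F => S.of_smul_clsU hHD hI h₁ h₃ hA hι hV k g F)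

/-- (Ported verbatim from the HodgeCMPerL package; no docstring in the source.) -/
theorem clsLift_symm_apply (hι : S.ιinf = archInfOf V) (hV : IsAnisotropic L V.Hm) (k : Fin 4) (F : S.holSatU hV k 𝓕) :
    S.clsLift hHD hI h₁ h₃ hA hι hV k 𝓕 ((S.holSatRep hV k 𝓕).asModuleEquiv.symm F) = S.clsU hHD hI h₁ h₃ hA 𝓕 hι hV k F := rfl

/-- Every class `clsU F` is a value of the `ℂ[G]`-linear lift. -/
theorem clsU_mem_range_clsLift (hι : S.ιinf = archInfOf V) (hV : IsAnisotropic L V.Hm) (k : Fin 4) (F : S.holSatU hV k 𝓕) :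
    S.clsU hHD hI h₁ h₃ hA 𝓕 hι hV k F ∈ LinearMap.range (S.clsLift hHD hI h₁ h₃ hA hι hV k 𝓕) :=
  EquivariantLift.mem_range_lift _ _ _ F

/-- **The `oscImage` shape**: every class `clsU F` lies in `⨆ ψ : (holSatRep).asModule →ₗ[A] Tower, range ψ`. -/
theorem clsU_mem_iSup_range (hι : S.ιinf = archInfOf V) (hV : IsAnisotropic L V.Hm) (k : Fin 4) (F : S.holSatU hV k 𝓕) :
    S.clsU hHD hI h₁ h₃ hA 𝓕 hι hV k F ∈
      ⨆ ψ : (S.holSatRep hV k 𝓕).asModule →ₗ[MonoidAlgebra ℂ ↥V.adelicFin]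
          Tower hHD hI (ballQuotientUniformisedDatum_of h₁) h₃ hA V,
        (LinearMap.range ψ).restrictScalars ℂ :=
  EquivariantLift.mem_iSup_range_of_equivariant _ _ (fun g F => S.of_smul_clsU hHD hI h₁ h₃ hA hι hV k g F) F

/-- **`K`-fixedness** of the classes at level `Γ`: `of k • clsU F = clsU F` for `k ∈ Γ.K` whenever `F ∈ holSat Γ`. -/
theorem of_smul_clsU_of_mem (hι : S.ιinf = archInfOf V) (hV : IsAnisotropic L V.Hm) (k : Fin 4) (F : S.holSatU hV k 𝓕)
    (i : TLvl V) (hi : F.1 ∈ S.holSat hV k i.1 𝓕) {kf : V.adelicFin} (hk : kf ∈ i.1.K) :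
    MonoidAlgebra.of ℂ ↥V.adelicFin kf • S.clsU hHD hI h₁ h₃ hA 𝓕 hι hV k F = S.clsU hHD hI h₁ h₃ hA 𝓕 hι hV k F := by
  rw [S.clsU_eq_clsAt hHD hI h₁ h₃ hA hι hV k F i hi]
  exact S.of_smul_clsAt_of_mem hHD hI h₁ h₃ hA hι hV k i.2 ⟨F.1, hi⟩ hk

/-- **Restriction** of the classes at level `Γ`: `res Γ (clsU F) = cl` for THE `(1,0)`-class with `(pull cl).1 = F ∘ S.ιinf`. -/
theorem res_clsU (hι : S.ιinf = archInfOf V) (hV : IsAnisotropic L V.Hm) (k : Fin 4)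
    (F : S.holSatU hV k 𝓕) (i : TLvl V) (hi : F.1 ∈ S.holSat hV k i.1 𝓕) (cl : (pinD hHD hI h₁ h₃ i.1 hV).H10)
    (hcl : ((pinD hHD hI h₁ h₃ i.1 hV).pull cl).1 = F.1 ∘ S.ιinf) :
    TowerCarrier.res hHD hI (ballQuotientUniformisedDatum_of h₁) h₃ hA i.1 i.2 (S.clsU hHD hI h₁ h₃ hA 𝓕 hι hV k F) =
      (cl : (picardCMUniverse hHD hI h₁ h₃).CohC ((picardCMUniverse hHD hI h₁ h₃).pms L ι₁ V i.1) 1) := by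
  rw [S.clsU_eq_clsAt hHD hI h₁ h₃ hA hι hV k F i hi]
  exact S.res_clsAt hHD hI h₁ h₃ hA hι hV k i.2 ⟨F.1, hi⟩ cl hcl

end Lift

end ThetaAdelicSide
end Model
end HodgeCM

end
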